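import Literature.Computability.AlgebraicComplexity.BI17PlethysmTypeSetBound
import Literature.Computability.AlgebraicComplexity.BI17OddCayleyInvariantProofs
import HarnessLib

/-!
# Bürgisser–Ikenmeyer 2017, Thm. 3.21 (Howe): `dim O(Sym^D ℂ^D)^{SL_D}_{D+1} = [D odd]` — the
# vanishing for even `D`, and the discharge of `BI2017_thm_3_21`

P. Bürgisser, C. Ikenmeyer, *Fundamental invariants of orbit closures*, J. Algebra **477** (2017)
390–434 = arXiv:1511.02927 [BurgisserIkenmeyer2017], §3.2.1, Thm. 3.21 (`\label{th:howeODD}`,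
`main.tex` L1251; held text `paper:arxiv-1511.02927`, p0011:L87): "If `D` is odd,
`dim O(Sym^D ℂ^D)^{SL_D}_{D+1} = 1`, otherwise `O(Sym^D ℂ^D)^{SL_D}_{D+1} = 0`" — attributed there
to [Howe 1987, Prop. 4.3]; BI give no proof. Typed (val-lit row BI2017-A, t04) as the named fact
`BI2017_thm_3_21` of `BI17FundamentalInvariantForms.lean`:
`∀ D, 0 < D → finrank ℂ (slInvariantsOfDegree (Fin D) ℂ D (D + 1)) = if Odd D then 1 else 0`.

This theorem-only companion (no definitions, no named facts) proves the fact: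

* **odd `D`**: the upper bound `≤ 1` is t01 g2's `finrank_slInvariantsOfDegree_succ_le_one`
  (`BI17PlethysmTypeSetBound.lean` §5, from App. Cor. 7.2), the lower bound is BI's own witness
  `P_D ≠ 0` (Thm. 3.22 (2), `oddCayleyP_ne_zero_of_odd`, `BI17OddCayleyInvariantProofs.lean`,
  val-lit t04 g3) together with `P_D ∈ O(Sym^D ℂ^D)^{SL_D}_{D+1}`
  (`tableauInvPoly_mem_slInvariantsOfDegree`);
* **even `D`** (the content of this file, `slInvariantsOfDegree_succ_eq_bot_of_even`): a NEW
  ELEMENTARY PROOF of Howe's vanishing, in the word model. An `SL_D`-invariant of degree `D + 1`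
  is a highest-weight vector of `k[Sym^D k^D]_{D+1}` of the rectangular dual weight
  `((D+1)^D)^*` (`slInvariantsOfDegree_le_highestWeightSpace`), i.e. — through the polarisation
  dictionary `highestWeightSpaceCoordRepEquiv` (BIP 2019 (4.1)) — an `S_{D+1} ≀ S_D`-invariant
  highest-weight vector of weight `((D+1)^D)` in `(k^D)^{⊗ (D+1)D}`, and by the tree's
  Fischer–Ikenmeyer Fact 1 in the word model (`finrank_wreathHW_transpose`: `Symⁿ Symᵐ ↔ Symⁿ Λᵐ`
  for even `m`, `dim wreathHW 1 λ = dim wreathHW s λᵀ`, `s = sign|_{S_n ≀ S_m}`) their number is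
  the dimension of the space of `s`-ISOTYPIC highest-weight vectors `x` of the transposed weight
  `(D^{D+1})` in `(k^{D+1})^{⊗ (D+1)D}` (`D + 1` blocks of `D` positions, alphabet of `D + 1`
  letters, every letter occurring `D` times). Such an `x` vanishes
  (`wreathHW_restrSign_eq_bot_of_even`): (i) `x(w) = 0` unless `w` has content `(D,…,D)`
  (weight vectors, `apply_eq_zero_of_mem_highestWeightSpace`); (ii) `x(w) = 0` if a letter repeats
  inside a block (the transposition of the two positions lies in `S_{D+1} ≀ S_D` and has sign `−1`);
  (iii) otherwise every block carries `D` distinct letters, so misses exactly one letter, and every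
  letter is missed by exactly one block; let `β_a`, `β_b` be the blocks missing the letters `a < b`
  and `w'` the word `w` with the letter `b` of `β_a` replaced by `a`. The raising operator
  `E_{ab}` kills highest-weight vectors (`wordRaise_eq_zero_of_mem_highestWeightSpace`, Fulton
  *Young Tableaux* §8.2 Lemma 4): `0 = (E_{ab} x)(w') = ∑_{p : w'(p) = a} x(w'[p ↦ b])`. The
  summand at the changed position is `x(w)`; at the letter `a` of `β_b` it is `x(w₁)` where
  `w₁ = w ∘ τ` for the block permutation `τ` exchanging `β_a` and `β_b` along their letters
  (`D` disjoint transpositions, `sign τ = (−1)^D`), so `x(w₁) = (−1)^D x(w)`; every other summand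
  has the letter `b` twice in its block and vanishes by (ii). For EVEN `D`: `2 x(w) = 0`. (For odd
  `D` the identity is vacuous, consistent with `P_D ≠ 0`.) In classical language this is the remark
  that the unique bracket monomial `∏_j [α_1 ⋯ α̂_j ⋯ α_{D+1}]` of degree `D + 1` in `D + 1`
  equivalent symbolic letters is alternating under `α_1 ↔ α_2` when `D` is even.

Main declarations: `wreathHW_restrSign_eq_bot_of_even` (word model),
`finrank_wreathHW_rectangle_succ_eq_zero_of_even` (untwisted side, via Fact 1),
`slInvariantsOfDegree_succ_eq_bot_of_even`, `finrank_slInvariantsOfDegree_succ_eq_zero_of_even`,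
`finrank_slInvariantsOfDegree_succ_eq_one_of_odd`, **`BI2017_thm_3_21_holds`**.

Honest framing (cell `val-lit`, rung V3): the discharge of one typed literature fact about the
invariant ring of `Sym^D ℂ^D` (BI 2017 §3.2.1, context for the fundamental invariant of power
sums); nothing here bears on VP versus VNP.

## References

* [BurgisserIkenmeyer2017] P. Bürgisser, C. Ikenmeyer, *Fundamental invariants of orbit closures*,
  J. Algebra 477 (2017) 390–434 = arXiv:1511.02927, §3.2.1 Thm. 3.21, Thm. 3.22, App. Cor. 7.2.
* [Howe1987] R. Howe, *`(GL_n, GL_m)`-duality and symmetric plethysm*, Proc. Indian Acad. Sci.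
  Math. Sci. 97 (1987) 85–109, Prop. 4.3 (the source BI cite; not held — the proof here is
  independent of it).
* [FischerIkenmeyer2020] N. Fischer, C. Ikenmeyer, Comput. Complexity 29 (2020) 8, §2 Fact 1
  (`Symⁿ Symᵐ V` versus `Symⁿ Λᵐ V` for even `m`; tree `finrank_wreathHW_transpose`).
* [BurgisserIkenmeyerPanovaJAMS2019] P. Bürgisser, C. Ikenmeyer, G. Panova, J. AMS 32 (2019), §4
  (4.1) (the word model of `Sym^d Sym^n V`).
* [FultonYoungTableaux1997] W. Fulton, *Young Tableaux*, LMS Student Texts 35, §8.2 (Lemma 4: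
  highest-weight vectors are killed by the raising operators `E_{ab}`).

## Tree

`wreathHW`, `restrSign`, `apply_comp_of_mem_wreathHW`, `finrank_wreathHW_transpose`,
`sign_outerBlockPerm`, `sign_innerBlockPerm` (`WreathHighestWeight`);
`highestWeightSpaceCoordRepEquiv` (`PlethysmWordModel`); `blockIdx`, `blockPerms`,
`swap_mem_blockPerms`, `outerBlockPerm`, `innerBlockPerm` (`PlethysmStability`); `wordRaise`,
`wordRaise_eq_zero_of_mem_highestWeightSpace`, `apply_eq_zero_of_mem_highestWeightSpace`,
`wordContent` (`SchurWeylPlethysmHwMultiplicityProofs`, `TensorWordModel`);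
`slInvariantsOfDegree_le_highestWeightSpace` (`BI17OddPlethysmColumnSets`);
`finrank_slInvariantsOfDegree_succ_le_one` (`BI17PlethysmTypeSetBound`);
`tableauInvPoly_mem_slInvariantsOfDegree` (`BI17PowerSumDegreeProofs`); `oddCayleyP_ne_zero_of_odd`
(`BI17OddCayleyInvariantProofs`); `BI2017_thm_3_21`, `slInvariantsOfDegree`, `oddCayleyP`
(`BI17FundamentalInvariantForms`).
-/

noncomputable section

open scoped BigOperators

namespace Literature.Computability.AlgebraicComplexity

open _root_.Literature.NumberTheory.DiophantineGeometry
open _root_.Literature.RepresentationTheory.GeneralLinear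

/-! ### §1 The sign-twisted word model: `s`-isotypic highest-weight vectors of weight `(m^{m+1})`
in `(k^{m+1})^{⊗ (m+1)m}` vanish for even `m` -/

section TwistedModel

variable {k : Type*} [Field k] [CharZero k] {m : ℕ}

/-- (ii) **A letter repeated inside a block kills the value**: if `w p = w q` for two positions
`p ≠ q` of one block, then `x w = 0` for every `s`-isotypic `x` (`s = sign|_{S_n ≀ S_m}`): the
transposition `(p q)` lies in the wreath product, fixes `w` and has sign `−1` — the vectors of
`Symⁿ Λᵐ V ⊆ V^{⊗nm}` vanish on words with a repeated letter in a block (FI 2020 §2, the model of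
Fact 1). [cite: FischerIkenmeyer2020, §2 (Fact 1)] -/
theorem apply_eq_zero_of_mem_wreathHW_restrSign_of_blockRepeat {n N : ℕ} {μ : Weight (Fin N)}
    {x : Word N (n * m) → k} (hx : x ∈ wreathHW k N (restrSign n m) μ)
    {w : Word N (n * m)} {p q : Fin (n * m)} (hpq : p ≠ q)
    (hblk : blockIdx n m p = blockIdx n m q) (hw : w p = w q) : x w = 0 := by
  classical
  have hfix : w ∘ ⇑(Equiv.swap p q) = w := by
    funext i
    simp only [Function.comp_apply]
    rcases eq_or_ne i p with rfl | hip
    · rw [Equiv.swap_apply_left, hw]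
    rcases eq_or_ne i q with rfl | hiq
    · rw [Equiv.swap_apply_right, hw]
    · rw [Equiv.swap_apply_of_ne_of_ne hip hiq]
  have h := apply_comp_of_mem_wreathHW hx ⟨Equiv.swap p q, swap_mem_blockPerms hblk⟩ w
  rw [hfix, restrSign_apply, Equiv.Perm.sign_swap hpq, Units.val_neg, Units.val_one,
    Int.cast_neg, Int.cast_one, neg_one_mul] at h
  have h2 : (2 : k) * x w = 0 := by linear_combination h
  exact (mul_eq_zero.mp h2).resolve_left two_ne_zero

/-- An injective map `Fin m → Fin (m + 1)` avoiding the letter `b` hits every other letter (its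
image has `m` elements inside the `m`-element complement of `{b}`). [folklore] -/
private theorem image_univ_eq_erase_of_injective_of_ne {f : Fin m → Fin (m + 1)}
    (hf : Function.Injective f) {b : Fin (m + 1)} (hb : ∀ i, f i ≠ b) :
    Finset.univ.image f = Finset.univ.erase b := by
  classical
  refine Finset.eq_of_subset_of_card_le (fun c hc => ?_) ?_
  · obtain ⟨i, -, rfl⟩ := Finset.mem_image.mp hc
    exact Finset.mem_erase.mpr ⟨hb i, Finset.mem_univ _⟩
  · rw [Finset.card_erase_of_mem (Finset.mem_univ _), Finset.card_univ, Fintype.card_fin,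
      Finset.card_image_of_injective _ hf, Finset.card_univ, Fintype.card_fin, Nat.add_sub_cancel]

/-- Two injective maps `Fin m → Fin (m + 1)` avoiding the same letter differ by a permutation of
`Fin m`: `v ∘ ε = u`. [folklore] -/
private theorem exists_perm_comp_eq_of_injective_of_ne {u v : Fin m → Fin (m + 1)}
    (hu : Function.Injective u) (hv : Function.Injective v) {b : Fin (m + 1)}
    (hub : ∀ i, u i ≠ b) (hvb : ∀ i, v i ≠ b) :
    ∃ ε : Equiv.Perm (Fin m), ∀ i, v (ε i) = u i := by
  classical
  have hrange : Set.range u = Set.range v := by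
    rw [← Set.image_univ, ← Set.image_univ, ← Finset.coe_univ, ← Finset.coe_image,
      ← Finset.coe_image, image_univ_eq_erase_of_injective_of_ne hu hub,
      image_univ_eq_erase_of_injective_of_ne hv hvb]
  refine ⟨(Equiv.ofInjective u hu).trans ((Equiv.setCongr hrange).trans
    (Equiv.ofInjective v hv).symm), fun i => ?_⟩
  rw [Equiv.trans_apply, Equiv.trans_apply, Equiv.apply_ofInjective_symm hv]
  rfl

/-- In a block carrying pairwise distinct letters from an alphabet of `m + 1` letters (`m`
positions), exactly one letter is missing. [folklore] -/
private theorem existsUnique_missingLetter {n : ℕ} {w : Word (m + 1) (n * m)} {r : Fin n}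
    (hinj : Function.Injective fun p : Fin m => w (finProdFinEquiv (r, p))) :
    ∃ a : Fin (m + 1), (∀ p, w (finProdFinEquiv (r, p)) ≠ a) ∧
      ∀ b, (∀ p, w (finProdFinEquiv (r, p)) ≠ b) → b = a := by
  classical
  set S := Finset.univ.image fun p : Fin m => w (finProdFinEquiv (r, p)) with hS
  have hcard : Sᶜ.card = 1 := by
    rw [Finset.card_compl, Fintype.card_fin, hS, Finset.card_image_of_injective _ hinj,
      Finset.card_univ, Fintype.card_fin, Nat.add_sub_cancel_left]
  obtain ⟨a, ha⟩ := Finset.card_eq_one.mp hcard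
  have key : ∀ b, (∀ p, w (finProdFinEquiv (r, p)) ≠ b) ↔ b ∈ Sᶜ := fun b => by
    rw [Finset.mem_compl, hS, Finset.mem_image]
    push Not
    exact ⟨fun h p _ => h p, fun h p => h p (Finset.mem_univ _)⟩
  refine ⟨a, (key a).mpr (by rw [ha]; exact Finset.mem_singleton_self a), fun b hb => ?_⟩
  have := (key b).mp hb
  rwa [ha, Finset.mem_singleton] at this

/-- If a letter `a` occurs exactly `m'` times in a word on `m' + 1` blocks (of any size `M`), never
twice in one block, then exactly one block misses `a`. [folklore] -/
private theorem existsUnique_missingBlock {N m' M : ℕ} {w : Word N ((m' + 1) * M)} {a : Fin N}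
    (hcont : wordContent w a = m')
    (hinj : ∀ p q : Fin ((m' + 1) * M), blockIdx (m' + 1) M p = blockIdx (m' + 1) M q →
      w p = a → w q = a → p = q) :
    ∃ β : Fin (m' + 1), (∀ p, w (finProdFinEquiv (β, p)) ≠ a) ∧
      ∀ r, (∀ p, w (finProdFinEquiv (r, p)) ≠ a) → r = β := by
  classical
  set A := Finset.univ.filter fun q : Fin ((m' + 1) * M) => w q = a with hA
  set B := A.image (blockIdx (m' + 1) M) with hB
  have hAcard : A.card = m' := hcont
  have hBcard : B.card = m' := by
    rw [hB, Finset.card_image_of_injOn fun p hp q hq h => ?_, hAcard]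
    exact hinj p q h (Finset.mem_filter.mp (Finset.mem_coe.mp hp)).2
      (Finset.mem_filter.mp (Finset.mem_coe.mp hq)).2
  have hcard : Bᶜ.card = 1 := by
    rw [Finset.card_compl, Fintype.card_fin, hBcard, Nat.add_sub_cancel_left]
  obtain ⟨β, hβ⟩ := Finset.card_eq_one.mp hcard
  have key : ∀ r, (∀ p, w (finProdFinEquiv (r, p)) ≠ a) ↔ r ∈ Bᶜ := fun r => by
    rw [Finset.mem_compl, hB, Finset.mem_image]
    constructor
    · rintro h ⟨q, hq, rfl⟩
      have hq' := (Finset.mem_filter.mp hq).2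
      apply h (finProdFinEquiv.symm q).2
      rw [finProdFinEquiv_blockIdx]
      exact hq'
    · intro h p hp
      exact h ⟨finProdFinEquiv (r, p), Finset.mem_filter.mpr ⟨Finset.mem_univ _, hp⟩,
        blockIdx_finProdFinEquiv r p⟩
  refine ⟨β, (key β).mpr (by rw [hβ]; exact Finset.mem_singleton_self β), fun r hr => ?_⟩
  have := (key r).mp hr
  rwa [hβ, Finset.mem_singleton] at this

/-- Positions of one block with equal images under `finProdFinEquiv` have equal places.
[folklore] -/
private theorem finProdFinEquiv_eq_iff_of_block {n : ℕ} (r : Fin n) (i j : Fin m) :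
    (finProdFinEquiv (r, i) : Fin (n * m)) = finProdFinEquiv (r, j) ↔ i = j := by
  rw [finProdFinEquiv.apply_eq_iff_eq, Prod.mk.injEq]
  exact ⟨fun h => h.2, fun h => ⟨rfl, h⟩⟩

/-- **Howe's vanishing in the sign-twisted word model** (the heart of BI 2017 Thm. 3.21 for even
`D = m`): for even `m ≥ 2`, the space of `s`-isotypic (`s = sign|_{S_{m+1} ≀ S_m}`) highest-weight
vectors of the constant weight `(m, …, m)` in the word model of `(k^{m+1})^{⊗ (m+1)m}` — the
highest-weight vectors of weight `(m^{m+1})` of `Sym^{m+1} Λ^m k^{m+1}` — is zero. Proof: module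
docstring, steps (i)–(iii). [cite: BurgisserIkenmeyer2017, Thm. 3.21]
[cite: FischerIkenmeyer2020, §2 (Fact 1)] -/
theorem wreathHW_restrSign_eq_bot_of_even (hm : Even m) (hm0 : 0 < m) {μ : Weight (Fin (m + 1))}
    (hμ : ∀ i, μ i = m) :
    wreathHW k (m + 1) (restrSign (m + 1) m) μ = ⊥ := by
  classical
  rw [Submodule.eq_bot_iff]
  intro x hx
  funext w
  rw [Pi.zero_apply]
  -- (i) `x` is supported on words of content `(m, …, m)`
  by_cases hc : ∀ i, wordContent w i = m
  swap
  · push Not at hc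
    obtain ⟨i, hi⟩ := hc
    exact apply_eq_zero_of_mem_highestWeightSpace k hx.1 (i := i) (by rw [hμ]; exact_mod_cast hi)
  -- (ii) … and on words with pairwise distinct letters in every block
  by_cases hinj : ∀ p q : Fin ((m + 1) * m),
      blockIdx (m + 1) m p = blockIdx (m + 1) m q → w p = w q → p = q
  swap
  · push Not at hinj
    obtain ⟨p, q, hbl, hw, hne⟩ := hinj
    exact apply_eq_zero_of_mem_wreathHW_restrSign_of_blockRepeat hx hne hbl hw
  -- (iii) the main case. Two letters `a < b`.
  have h1 : 1 < m + 1 := by omega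
  obtain ⟨a, ha⟩ : ∃ a : Fin (m + 1), a = ⟨0, Nat.succ_pos m⟩ := ⟨_, rfl⟩
  obtain ⟨b, hb⟩ : ∃ b : Fin (m + 1), b = ⟨1, h1⟩ := ⟨_, rfl⟩
  have hab : a < b := by rw [ha, hb]; exact Fin.mk_lt_mk.mpr Nat.zero_lt_one
  have hab' : a ≠ b := hab.ne
  have hinjr : ∀ r : Fin (m + 1),
      Function.Injective fun p : Fin m => w (finProdFinEquiv (r, p)) := by
    intro r p q h
    have := hinj _ _ (by rw [blockIdx_finProdFinEquiv, blockIdx_finProdFinEquiv]) h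
    exact (finProdFinEquiv_eq_iff_of_block r p q).mp this
  have hinja : ∀ c : Fin (m + 1), ∀ p q : Fin ((m + 1) * m),
      blockIdx (m + 1) m p = blockIdx (m + 1) m q → w p = c → w q = c → p = q :=
    fun c p q hbl hp hq => hinj p q hbl (hp.trans hq.symm)
  -- every block misses exactly one letter; every letter is missed by exactly one block
  have hmiss : ∀ (r : Fin (m + 1)) (c d : Fin (m + 1)), (∀ p, w (finProdFinEquiv (r, p)) ≠ c) →
      (∀ p, w (finProdFinEquiv (r, p)) ≠ d) → c = d := by
    intro r c d hc' hd'
    obtain ⟨e, -, he⟩ := existsUnique_missingLetter (hinjr r)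
    rw [he c hc', he d hd']
  obtain ⟨β₀, hβ₀, -⟩ := existsUnique_missingBlock (hc a) (hinja a)
  obtain ⟨β₁, hβ₁, hβ₁u⟩ := existsUnique_missingBlock (hc b) (hinja b)
  have hβne : β₀ ≠ β₁ := by
    rintro rfl
    exact hab' (hmiss β₀ a b hβ₀ hβ₁)
  -- the letter `b` of block `β₀` (position `q₀`) and the letter `a` of block `β₁` (position `q₁`)
  obtain ⟨p₀, hp₀⟩ : ∃ p, w (finProdFinEquiv (β₀, p)) = b := by
    by_contra h
    push Not at h
    exact hab' (hmiss β₀ a b hβ₀ h)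
  obtain ⟨p₁, hp₁⟩ : ∃ p, w (finProdFinEquiv (β₁, p)) = a := by
    by_contra h
    push Not at h
    exact hab' (hmiss β₁ a b h hβ₁)
  obtain ⟨q₀, hq₀⟩ : ∃ q : Fin ((m + 1) * m), q = finProdFinEquiv (β₀, p₀) := ⟨_, rfl⟩
  obtain ⟨q₁, hq₁⟩ : ∃ q : Fin ((m + 1) * m), q = finProdFinEquiv (β₁, p₁) := ⟨_, rfl⟩
  have hwq₀ : w q₀ = b := by rw [hq₀]; exact hp₀
  have hwq₁ : w q₁ = a := by rw [hq₁]; exact hp₁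
  have hbq₀ : blockIdx (m + 1) m q₀ = β₀ := by rw [hq₀, blockIdx_finProdFinEquiv]
  have hbq₁ : blockIdx (m + 1) m q₁ = β₁ := by rw [hq₁, blockIdx_finProdFinEquiv]
  have hq01 : q₀ ≠ q₁ := fun h => hβne (by rw [← hbq₀, ← hbq₁, h])
  -- the test word `w' = w[q₀ ↦ a]` and the raising operator `E_{ab}`
  obtain ⟨w', hw'⟩ : ∃ w' : Word (m + 1) ((m + 1) * m), w' = Function.update w q₀ a := ⟨_, rfl⟩
  have hw'q₀ : w' q₀ = a := by rw [hw', Function.update_self]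
  have hw'of : ∀ q, q ≠ q₀ → w' q = w q := fun q hq => by rw [hw', Function.update_of_ne hq]
  have hw'q₁ : w' q₁ = a := by rw [hw'of q₁ hq01.symm, hwq₁]
  have hE := congrFun (wordRaise_eq_zero_of_mem_highestWeightSpace (k := k) hab hx.1) w'
  rw [wordRaise_apply, Pi.zero_apply] at hE
  rw [Finset.sum_eq_add_of_mem q₀ q₁ (Finset.mem_filter.mpr ⟨Finset.mem_univ _, hw'q₀⟩)
    (Finset.mem_filter.mpr ⟨Finset.mem_univ _, hw'q₁⟩) hq01] at hE
  swap
  · -- every other summand has the letter `b` twice in its block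
    rintro q hq ⟨hne₀, hne₁⟩
    have hwq : w q = a := by rw [← hw'of q hne₀]; exact (Finset.mem_filter.mp hq).2
    obtain ⟨r, hr⟩ : ∃ r, r = blockIdx (m + 1) m q := ⟨_, rfl⟩
    have hqr : finProdFinEquiv (r, (finProdFinEquiv.symm q).2) = q := by
      rw [hr]; exact finProdFinEquiv_blockIdx q
    have hr₀ : r ≠ β₀ := by
      intro h
      apply hβ₀ (finProdFinEquiv.symm q).2
      rw [← h, hqr, hwq]
    have hr₁ : r ≠ β₁ := by
      intro h
      exact hne₁ (hinja a q q₁ (by rw [← hr, h, hbq₁]) hwq hwq₁)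
    obtain ⟨p', hp'⟩ : ∃ p, w (finProdFinEquiv (r, p)) = b := by
      by_contra h
      push Not at h
      exact hr₁ (hβ₁u r h)
    have hq'q : finProdFinEquiv (r, p') ≠ q := by
      intro h
      rw [h, hwq] at hp'
      exact hab' hp'
    have hq'₀ : finProdFinEquiv (r, p') ≠ q₀ := by
      intro h
      apply hr₀
      rw [← hbq₀, ← h, blockIdx_finProdFinEquiv]
    refine apply_eq_zero_of_mem_wreathHW_restrSign_of_blockRepeat hx hq'q
      (by rw [blockIdx_finProdFinEquiv, hr]) ?_
    rw [Function.update_self, Function.update_of_ne hq'q, hw'of _ hq'₀, hp']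
  -- the first summand is `x w`
  have h0 : Function.update w' q₀ b = w := by
    rw [hw', Function.update_idem, ← hwq₀, Function.update_eq_self]
  rw [h0] at hE
  -- the second summand is `x w₁`, `w₁ = w ∘ τ` for a block permutation of sign `(−1)^m = 1`
  obtain ⟨w₁, hw₁⟩ : ∃ w₁ : Word (m + 1) ((m + 1) * m), w₁ = Function.update w' q₁ b := ⟨_, rfl⟩
  rw [← hw₁] at hE
  -- the letters of `w₁` block by block
  have hw₁β₀ : ∀ i, w₁ (finProdFinEquiv (β₀, i)) =
      if i = p₀ then a else w (finProdFinEquiv (β₀, i)) := by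
    intro i
    have hne : (finProdFinEquiv (β₀, i) : Fin ((m + 1) * m)) ≠ q₁ := by
      intro h
      apply hβne
      rw [← hbq₁, ← h, blockIdx_finProdFinEquiv]
    rw [hw₁, Function.update_of_ne hne, hw']
    by_cases hi : i = p₀
    · rw [if_pos hi, hi, ← hq₀, Function.update_self]
    · rw [if_neg hi, Function.update_of_ne]
      rw [hq₀, Ne, finProdFinEquiv_eq_iff_of_block]
      exact hi
  have hw₁β₁ : ∀ i, w₁ (finProdFinEquiv (β₁, i)) =
      if i = p₁ then b else w (finProdFinEquiv (β₁, i)) := by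
    intro i
    rw [hw₁]
    by_cases hi : i = p₁
    · rw [if_pos hi, hi, ← hq₁, Function.update_self]
    · have hne : (finProdFinEquiv (β₁, i) : Fin ((m + 1) * m)) ≠ q₁ := by
        rw [hq₁, Ne, finProdFinEquiv_eq_iff_of_block]
        exact hi
      rw [if_neg hi, Function.update_of_ne hne, hw'of]
      intro h
      apply hβne
      rw [← hbq₀, ← h, blockIdx_finProdFinEquiv]
  have hw₁of : ∀ r i, r ≠ β₀ → r ≠ β₁ →
      w₁ (finProdFinEquiv (r, i)) = w (finProdFinEquiv (r, i)) := by
    intro r i hr₀ hr₁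
    have hne₁ : (finProdFinEquiv (r, i) : Fin ((m + 1) * m)) ≠ q₁ := by
      intro h; apply hr₁; rw [← hbq₁, ← h, blockIdx_finProdFinEquiv]
    have hne₀ : (finProdFinEquiv (r, i) : Fin ((m + 1) * m)) ≠ q₀ := by
      intro h; apply hr₀; rw [← hbq₀, ← h, blockIdx_finProdFinEquiv]
    rw [hw₁, Function.update_of_ne hne₁, hw'of _ hne₀]
  -- the letter matching `ε` of block `β₀` of `w₁` with block `β₁` of `w`
  have hu_inj : Function.Injective fun i : Fin m => w₁ (finProdFinEquiv (β₀, i)) := by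
    intro i j h
    simp only [hw₁β₀] at h
    by_cases hi : i = p₀
    · by_cases hj : j = p₀
      · rw [hi, hj]
      · rw [if_pos hi, if_neg hj] at h
        exact absurd h.symm (hβ₀ j)
    · by_cases hj : j = p₀
      · rw [if_neg hi, if_pos hj] at h
        exact absurd h (hβ₀ i)
      · rw [if_neg hi, if_neg hj] at h
        exact hinjr β₀ h
  have hub : ∀ i, w₁ (finProdFinEquiv (β₀, i)) ≠ b := by
    intro i
    rw [hw₁β₀]
    by_cases hi : i = p₀
    · rw [if_pos hi]; exact hab'
    · rw [if_neg hi]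
      intro h
      exact hi (hinjr β₀ (h.trans hp₀.symm))
  obtain ⟨ε, hε⟩ := exists_perm_comp_eq_of_injective_of_ne hu_inj (hinjr β₁) hub hβ₁
  -- the block permutation `τ`
  obtain ⟨e, he⟩ : ∃ e : Fin (m + 1) → Equiv.Perm (Fin m),
      e = Function.update (Function.update (fun _ => 1) β₀ ε) β₁ ε⁻¹ := ⟨_, rfl⟩
  have heβ₀ : e β₀ = ε := by
    rw [he, Function.update_of_ne hβne, Function.update_self]
  have heβ₁ : e β₁ = ε⁻¹ := by rw [he, Function.update_self]
  have heof : ∀ r, r ≠ β₀ → r ≠ β₁ → e r = 1 := fun r hr₀ hr₁ => by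
    rw [he, Function.update_of_ne hr₁, Function.update_of_ne hr₀]
  obtain ⟨τ, hτ⟩ : ∃ τ : Equiv.Perm (Fin ((m + 1) * m)),
      τ = outerBlockPerm (m + 1) m (Equiv.swap β₀ β₁) * innerBlockPerm (m + 1) m e := ⟨_, rfl⟩
  have hτmem : τ ∈ blockPerms (m + 1) m := by
    rw [hτ]
    exact (blockPerms (m + 1) m).mul_mem (outerBlockPerm_mem_blockPerms _)
      (innerBlockPerm_mem_blockPerms _)
  have hprod : ∏ r, Equiv.Perm.sign (e r) = 1 := by
    have hrest : ∏ r ∈ (Finset.univ.erase β₀).erase β₁, Equiv.Perm.sign (e r) = 1 :=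
      Finset.prod_eq_one fun r hr => by
        obtain ⟨hr₁, hr'⟩ := Finset.mem_erase.mp hr
        obtain ⟨hr₀, -⟩ := Finset.mem_erase.mp hr'
        rw [heof r hr₀ hr₁, map_one]
    rw [← Finset.mul_prod_erase Finset.univ _ (Finset.mem_univ β₀),
      ← Finset.mul_prod_erase _ _ (Finset.mem_erase.mpr ⟨hβne.symm, Finset.mem_univ β₁⟩),
      hrest, mul_one, heβ₀, heβ₁, Equiv.Perm.sign_inv, Int.units_mul_self]
  have hsign : Equiv.Perm.sign τ = 1 := by
    rw [hτ, map_mul, sign_outerBlockPerm, sign_innerBlockPerm, Equiv.Perm.sign_swap hβne, hprod,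
      mul_one]
    exact hm.neg_one_pow
  have hcomp : w ∘ ⇑τ = w₁ := by
    funext q
    obtain ⟨⟨r, i⟩, rfl⟩ := finProdFinEquiv.surjective q
    rw [Function.comp_apply, hτ, Equiv.Perm.mul_apply, innerBlockPerm_apply, outerBlockPerm_apply]
    by_cases hr₀ : r = β₀
    · rw [hr₀, heβ₀, Equiv.swap_apply_left, hε i]
    by_cases hr₁ : r = β₁
    · rw [hr₁, heβ₁, Equiv.swap_apply_right, hw₁β₁]
      -- `w (β₀, ε⁻¹ i) = w₁ (β₁, i)`
      obtain ⟨j, rfl⟩ : ∃ j, ε j = i := ⟨ε.symm i, ε.apply_symm_apply i⟩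
      rw [Equiv.Perm.inv_def, Equiv.symm_apply_apply]
      have hεj := hε j
      rw [hw₁β₀] at hεj
      by_cases hj : j = p₀
      · rw [if_pos hj] at hεj
        have hi : ε j = p₁ := hinjr β₁ (hεj.trans hp₁.symm)
        rw [if_pos hi, hj, ← hq₀, hwq₀]
      · rw [if_neg hj] at hεj
        have hi : ε j ≠ p₁ := by
          intro h
          rw [h, hp₁] at hεj
          exact hβ₀ j hεj.symm
        rw [if_neg hi, hεj]
    · rw [heof r hr₀ hr₁, Equiv.Perm.one_apply, Equiv.swap_apply_of_ne_of_ne hr₀ hr₁,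
        hw₁of r i hr₀ hr₁]
  -- `x w₁ = x w`
  have hx₁ : x w₁ = x w := by
    have := apply_comp_of_mem_wreathHW hx ⟨τ, hτmem⟩ w
    rwa [hcomp, restrSign_apply, Subgroup.coe_mk, hsign, Units.val_one, Int.cast_one,
      one_mul] at this
  rw [hx₁] at hE
  have h2 : (2 : k) * x w = 0 := by linear_combination hE
  exact (mul_eq_zero.mp h2).resolve_left two_ne_zero

end TwistedModel

/-! ### §2 Back to `Sym^{m+1} Sym^m` (Fischer–Ikenmeyer Fact 1) and to `O(Sym^D ℂ^D)^{SL_D}_{D+1}` -/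

section Untwist

variable {k : Type*} [Field k] [CharZero k] {m : ℕ}

/-- **No `S_{m+1} ≀ S_m`-invariant highest-weight vectors of weight `((m+1)^m)` in
`(k^m)^{⊗ (m+1)m}` for even `m ≥ 2`** — i.e. the plethysm coefficient `a_{((m+1)^m)}(m+1, m)`
vanishes: by Fact 1 (`finrank_wreathHW_transpose`) their number is the dimension of the
`s`-isotypic highest-weight vectors of the transposed weight `(m^{m+1})`, zero by
`wreathHW_restrSign_eq_bot_of_even`. Stated for any partition `λ` of `(m+1)·m` whose transpose has
the constant weight `(m, …, m)` on `m + 1` letters (the rectangle `m × (m+1)`; the index of the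
partition is kept abstract to absorb `m·(m+1) = (m+1)·m`). [cite: BurgisserIkenmeyer2017, Thm. 3.21]
[cite: FischerIkenmeyer2020, §2 (Fact 1)] -/
theorem finrank_wreathHW_one_eq_zero_of_even {s : ℕ} (hm : Even m) (hm0 : 0 < m)
    (hs : s = (m + 1) * m) (lam : Nat.Partition s) (hlam : lam.parts.card ≤ m)
    (hlam' : lam.transpose.parts.card ≤ m + 1)
    (hwt : ∀ i : Fin (m + 1), Weight.ofPartition (m + 1) lam.transpose i = m) :
    Module.finrank k
      (wreathHW k m (1 : ↥(blockPerms (m + 1) m) →* ℤˣ) (Weight.ofPartition m lam)) = 0 := by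
  subst hs
  rw [finrank_wreathHW_transpose k 1 lam hlam hlam', mul_one,
    wreathHW_restrSign_eq_bot_of_even hm hm0 hwt, finrank_bot]

/-- The same vanishing read in `k[Sym^m (k^m)]`: **no highest-weight vectors of the dual
rectangular weight `((m+1)^m)^*` among the polynomial functions on `Sym^m k^m`** (even `m ≥ 2`),
through the polarisation dictionary `highestWeightSpaceCoordRepEquiv` (BIP 2019 (4.1)).
[cite: BurgisserIkenmeyer2017, Thm. 3.21] [cite: BurgisserIkenmeyerPanovaJAMS2019, §4 (4.1)] -/
theorem highestWeightSpace_coordRep_eq_bot_of_even {s : ℕ} (hm : Even m) (hm0 : 0 < m)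
    (hs : s = (m + 1) * m) (lam : Nat.Partition s) (hlam : lam.parts.card ≤ m)
    (hlam' : lam.transpose.parts.card ≤ m + 1)
    (hwt : ∀ i : Fin (m + 1), Weight.ofPartition (m + 1) lam.transpose i = m) :
    highestWeightSpace (coordRep (Fin m) k m) (Weight.dualOfPartition m lam) = ⊥ := by
  have h0 := finrank_wreathHW_one_eq_zero_of_even (k := k) hm hm0 hs lam hlam hlam' hwt
  subst hs
  set e := highestWeightSpaceCoordRepEquiv k m (Nat.pos_iff_ne_zero.mp hm0) lam hlam
  haveI : Module.Finite k
      ↥(highestWeightSpace (coordRep (Fin m) k m) (Weight.dualOfPartition m lam)) :=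
    Module.Finite.equiv e.symm
  apply Submodule.finrank_eq_zero.mp
  rw [e.finrank_eq, h0]

/-- The transpose (conjugate) of the rectangle `D × (D+1)` has at most `D + 1` parts (exactly
`D + 1` for `D ≥ 1`): the conjugate of `(b^a)` is `(a^b)`.
[cite: FultonYoungTableaux1997, §0 (the conjugate partition)] -/
theorem card_parts_transpose_rectangle_succ_le (D : ℕ) :
    (Nat.Partition.rectangle D (D + 1)).transpose.parts.card ≤ D + 1 := by
  show ((Nat.Partition.rectangle D (D + 1)).youngDiagram.transpose.rowLens : Multiset ℕ).card ≤ D + 1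
  rw [Multiset.coe_card, YoungDiagram.length_rowLens, YoungDiagram.colLen_transpose,
    rowLen_youngDiagram, Nat.Partition.sortedParts_rectangle D (D + 1) (Nat.succ_ne_zero D),
    List.getD_eq_getElem?_getD, List.getElem?_replicate]
  split_ifs <;> simp

/-- The weight of the transpose (conjugate) of the rectangle `D × (D+1)` on `D + 1` letters is the
constant weight `(D, …, D)`: the conjugate of `(b^a)` is `(a^b)`, all columns of the rectangle
having length `D`. [cite: FultonYoungTableaux1997, §0 (the conjugate partition)] -/
theorem ofPartition_transpose_rectangle_succ_apply {D : ℕ} (i : Fin (D + 1)) :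
    Weight.ofPartition (D + 1) (Nat.Partition.rectangle D (D + 1)).transpose i = D := by
  rw [Weight.ofPartition_apply, ← rowLen_youngDiagram, Nat.Partition.youngDiagram_transpose,
    YoungDiagram.rowLen_transpose]
  congr 1
  refine eq_of_forall_lt_iff fun j => ?_
  rw [← YoungDiagram.mem_iff_lt_colLen, mem_youngDiagram_rectangle_iff]
  exact ⟨fun h => h.1, fun h => ⟨h, i.2⟩⟩

/-- **BI 2017 Thm. 3.21 (Howe), the even case: `O(Sym^D ℂ^D)^{SL_D}_{D+1} = 0` for even `D ≥ 2`.**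
An `SL_D`-invariant of degree `D + 1` is a highest-weight vector of the dual rectangular weight
`((D+1)^D)^*` (`slInvariantsOfDegree_le_highestWeightSpace`), and there are none
(`highestWeightSpace_coordRep_eq_bot_of_even`). [cite: BurgisserIkenmeyer2017, Thm. 3.21] -/
theorem slInvariantsOfDegree_succ_eq_bot_of_even {D : ℕ} (hD : Even D) (hD0 : 0 < D) :
    slInvariantsOfDegree (Fin D) ℂ D (D + 1) = ⊥ := by
  have hbot := highestWeightSpace_coordRep_eq_bot_of_even (k := ℂ) hD hD0 (Nat.mul_comm D (D + 1))
    (Nat.Partition.rectangle D (D + 1)) (Nat.Partition.card_parts_rectangle_le D (D + 1))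
    (card_parts_transpose_rectangle_succ_le D) ofPartition_transpose_rectangle_succ_apply
  have hdual : Weight.dualOfPartition D (Nat.Partition.rectangle D (D + 1)) =
      fun _ => -((D * (D + 1) / D : ℕ) : ℤ) := by
    funext i
    simp only [Weight.dualOfPartition, Weight.dual, Weight.ofPartition_rectangle_apply,
      Nat.mul_div_cancel_left _ hD0]
  rw [eq_bot_iff, ← hbot, hdual]
  exact slInvariantsOfDegree_le_highestWeightSpace hD0 (dvd_mul_right D (D + 1))

/-- **Even case, dimension form**: `dim O(Sym^D ℂ^D)^{SL_D}_{D+1} = 0` for even `D ≥ 2`.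
[cite: BurgisserIkenmeyer2017, Thm. 3.21] -/
theorem finrank_slInvariantsOfDegree_succ_eq_zero_of_even {D : ℕ} (hD : Even D) (hD0 : 0 < D) :
    Module.finrank ℂ (slInvariantsOfDegree (Fin D) ℂ D (D + 1)) = 0 := by
  rw [slInvariantsOfDegree_succ_eq_bot_of_even hD hD0, finrank_bot]

end Untwist

/-! ### §3 The odd case and the discharge -/

section Discharge

/-- **BI 2017 Thm. 3.21 (Howe), the odd case: `dim O(Sym^D ℂ^D)^{SL_D}_{D+1} = 1` for odd `D`.**
Upper bound: App. Cor. 7.2 (`finrank_slInvariantsOfDegree_succ_le_one`). Lower bound: BI's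
invariant `P_D` of the cyclic tableau (eq. (3.7)) lies in `O(Sym^D ℂ^D)^{SL_D}_{D+1}`
(`tableauInvPoly_mem_slInvariantsOfDegree`) and is nonzero for odd `D` (Thm. 3.22 (2),
`oddCayleyP_ne_zero_of_odd`). [cite: BurgisserIkenmeyer2017, Thm. 3.21] -/
theorem finrank_slInvariantsOfDegree_succ_eq_one_of_odd {D : ℕ} (hD : Odd D) :
    Module.finrank ℂ (slInvariantsOfDegree (Fin D) ℂ D (D + 1)) = 1 := by
  refine le_antisymm (finrank_slInvariantsOfDegree_succ_le_one hD) ?_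
  haveI : Module.Finite ℂ (MvPolynomial.homogeneousSubmodule (DegIdx (Fin D) D) ℂ (D + 1)) :=
    Module.Finite.iff_fg.mpr (MvPolynomial.homogeneousSubmodule_fg _ _ _)
  haveI : Module.Finite ℂ (slInvariantsOfDegree (Fin D) ℂ D (D + 1)) :=
    Submodule.finiteDimensional_of_le
      (show slInvariantsOfDegree (Fin D) ℂ D (D + 1) ≤
        MvPolynomial.homogeneousSubmodule (DegIdx (Fin D) D) ℂ (D + 1) from inf_le_left)
  have hP : oddCayleyP (k := ℂ) D (Equiv.refl (Fin D)) ∈ slInvariantsOfDegree (Fin D) ℂ D (D + 1) :=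
    tableauInvPoly_mem_slInvariantsOfDegree (k := ℂ) (cyclicTableau D)
  have hne := oddCayleyP_ne_zero_of_odd hD
  exact Module.finrank_pos_iff_exists_ne_zero.mpr
    ⟨⟨_, hP⟩, fun h => hne (congrArg Subtype.val h)⟩

/-- **BI 2017, Thm. 3.21 (Howe 1987, Prop. 4.3) — DISCHARGE of the named fact `BI2017_thm_3_21`**
(`BI17FundamentalInvariantForms.lean`): "If `D` is odd, `dim O(Sym^D ℂ^D)^{SL_D}_{D+1} = 1`,
otherwise `O(Sym^D ℂ^D)^{SL_D}_{D+1} = 0`" (`D ≥ 1`). Assembled from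
`finrank_slInvariantsOfDegree_succ_eq_one_of_odd` and
`finrank_slInvariantsOfDegree_succ_eq_zero_of_even`. [cite: BurgisserIkenmeyer2017, Thm. 3.21] -/
theorem BI2017_thm_3_21_holds : BI2017_thm_3_21 := by
  intro D hD0
  split_ifs with hO
  · exact finrank_slInvariantsOfDegree_succ_eq_one_of_odd hO
  · exact finrank_slInvariantsOfDegree_succ_eq_zero_of_even (Nat.not_odd_iff_even.mp hO) hD0

end Discharge

end Literature.Computability.AlgebraicComplexity

end
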